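import Summits.AtomisticToContinuum.HydrodynamicLimit.Theorems.CollisionIsometryCLTMacroClosureEngineBlockClosureA
import Summits.AtomisticToContinuum.HydrodynamicLimit.Theorems.CollisionIsometryCLTMacroClosureStubClausiusTotals
import Summits.AtomisticToContinuum.HydrodynamicLimit.Theorems.CollisionIsometryCLTCollisionalTransferLocalityCompressibilityBound
import Summits.AtomisticToContinuum.HydrodynamicLimit.Theses.StiffCollisionalRelaxation
import Mathlib.MeasureTheory.Integral.MeanInequalities
import HarnessLib

/-!
# Sub-goal `engine_blockClosure` of the lead's stub `stub_engine_pointwise` (line `IdeatorTwoGen1Sketch`, crux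
# `MacroClosure`, stmt-AtomisticToContinuum-14870) — helpers B: block analysis on a band block

Support file (`--supports stmt-AtomisticToContinuum-14870`) for the registered sub-goal
`Barycentric.engine_blockClosure`, namespace `Barycentric.EngineBlockClosure`. For a continuous kernel
`φ ≥ 0` of unit mass and a configuration `w` whose blocks lie in the band `c₁ ≤ ρ̄ ≤ σ⁻³`:

* `continuous_blocks` — `ū, θ̄, D, q` are continuous in the block centre (`ρ̄ ≥ c₁ > 0`);
* `integrable_pressure` — the block pressure `x ↦ p(ρ̄(x), θ̄(x)) = ρ̄ θ̄ Z(ρ̄σ³)` is integrable: `Z` is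
  measurable (`deriv` of any function is measurable) and bounded on the band by Ruelle convexity
  (`HsFreeEnergyConvex`, through `HemisphereAffineSlaving.abs_hsCompressibility_sub_one_le`);
* `integral_one_add_norm_bu_sq_le` — `∫ₓ (1 + |ū|)² ≤ 2(1 + c₁⁻¹)(1 + ⟨emp w, |v|²⟩)`
  (`|m̄|² ≤ 2ρ̄Ē`, `∫ₓ Ē = ⟨emp, |v|²/2⟩`);
* `integral_rem_le` — the integrated kinetic remainder is at most
  `12 L √(2(1 + c₁⁻¹)) · (∫ₓ Σ D² + |q|²)^{1/2} (1 + ⟨emp, |v|²⟩)^{1/2}`;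
* `family_bounds` — uniform sup and Lipschitz bounds on `[0, t] × 𝕋³` for finite families of fields
  jointly smooth on `[0, T) × 𝕋³`, `t < T`.
-/

noncomputable section

open MeasureTheory Filter Set Topology InformationTheory
open scoped ENNReal ContDiff

namespace Summit.AtomisticToContinuum.HydrodynamicLimit.Theorems.MacroClosureLine

open Literature.MathematicalPhysics.KineticTheory Literature.Analysis.FluidPDE
open Literature.Analysis.FunctionSpaces
open Summit.AtomisticToContinuum.HydrodynamicLimit.Theses

namespace Barycentric

namespace EngineBlockClosure

variable {n : ℕ}

/-! ## Continuity of the block fields on blocks of positive density -/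

/-- On a configuration all of whose blocks have `ρ̄ ≠ 0`, the block velocity, temperature, traceless
stress and heat flux are continuous in the block centre. -/
theorem continuous_blocks {φ : T3 → ℝ} (hφc : Continuous φ) (w : Config (n + 1) (Fin 3) T3)
    (hρ : ∀ x, bρ φ w x ≠ 0) :
    (Continuous fun x => bu φ w x) ∧ (∀ j, Continuous fun x => bu φ w x j) ∧
    (∀ j, Continuous fun x => bm φ w x j) ∧ (Continuous fun x => bθ φ w x) ∧
    (∀ j k, Continuous fun x => bD φ w x j k) ∧ (Continuous fun x => bq φ w x) ∧
    ∀ j, Continuous fun x => bq φ w x j := by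
  have hρc := Clausius.continuous_bρ hφc w
  have hmc := Clausius.continuous_bm hφc w
  have hEc := Clausius.continuous_bE hφc w
  have hproj : ∀ {f : T3 → V3}, Continuous f → ∀ j, Continuous fun x => f x j := fun hf j =>
    (EuclideanSpace.proj j : V3 →L[ℝ] ℝ).continuous.comp hf
  have hu : Continuous fun x => bu φ w x := (hρc.inv₀ hρ).smul hmc
  have huj : ∀ j, Continuous fun x => bu φ w x j := hproj hu
  have hθ : Continuous fun x => bθ φ w x := by
    refine continuous_const.mul ((hEc.div hρc hρ).sub ((hmc.norm.pow 2).div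
      (continuous_const.mul (hρc.pow 2)) fun x => ?_))
    exact mul_ne_zero two_ne_zero (pow_ne_zero 2 (hρ x))
  have hφx : ∀ i : Fin (n + 1), Continuous fun x => φ ((w i).1 - x) := fun i =>
    hφc.comp (continuous_const.sub continuous_id)
  have hD : ∀ j k, Continuous fun x => bD φ w x j k := by
    intro j k
    have hA : Continuous fun x => ∫ y, φ (y.1 - x) * ((y.2 j - bu φ w x j) * (y.2 k - bu φ w x k))
        ∂(empiricalMeasure w) := by
      simp only [integral_weight_mul_eq_sum]
      exact continuous_const.mul (continuous_finsetSum _ fun i _ => (hφx i).mul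
        ((continuous_const.sub (huj j)).mul (continuous_const.sub (huj k))))
    have hB : Continuous fun x => (∑ l : Fin 3, ∫ y, φ (y.1 - x) * (y.2 l - bu φ w x l) ^ 2
        ∂(empiricalMeasure w)) / 3 := by
      simp only [integral_weight_mul_eq_sum]
      exact (continuous_finsetSum _ fun l _ => continuous_const.mul
        (continuous_finsetSum _ fun i _ => (hφx i).mul ((continuous_const.sub (huj l)).pow 2))).div_const _
    by_cases hjk : j = k
    · simp only [bD, hjk, if_true]
      subst hjk
      exact hA.sub hB
    · simp only [bD, hjk, if_false]
      exact hA.sub continuous_const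
  have hq : Continuous fun x => bq φ w x := by
    have e : (fun x => bq φ w x) = fun x => ((n + 1 : ℕ) : ℝ)⁻¹ •
        ∑ i, (φ ((w i).1 - x) * ‖(w i).2 - bu φ w x‖ ^ 2 / 2) • ((w i).2 - bu φ w x) := by
      funext x
      simp only [bq]
      rw [integral_empiricalMeasure_V3]
    rw [e]
    exact (continuous_finsetSum _ fun i _ =>
      (((hφx i).mul ((continuous_const.sub hu).norm.pow 2)).div_const _).smul
        (continuous_const.sub hu)).const_smul (((n + 1 : ℕ) : ℝ)⁻¹)
  exact ⟨hu, huj, hproj hmc, hθ, hD, hq, hproj hq⟩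

/-! ## Integrability of the block pressure on the band -/

/-- **The block pressure is integrable on a band configuration**: `p(ρ̄, θ̄) = ρ̄ θ̄ Z(ρ̄σ³)` with
`ρ̄ θ̄` continuous and `Z(ρ̄σ³)` measurable and bounded by `1 + C_Z` on `c₁ ≤ ρ̄ ≤ σ⁻³`
(Ruelle convexity). -/
theorem integrable_pressure (hH : StiffCollisionalRelaxation.HsFreeEnergyConvex) {σ c₁ : ℝ}
    (hσ : 0 < σ) (hc₁ : 0 < c₁) {φ : T3 → ℝ} (hφc : Continuous φ) (w : Config (n + 1) (Fin 3) T3)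
    (hband : ∀ x, c₁ ≤ bρ φ w x ∧ bρ φ w x * σ ^ 3 ≤ 1) (hθc : Continuous fun x => bθ φ w x) :
    Integrable (fun x => hsPressure σ (bρ φ w x) (bθ φ w x)) := by
  obtain ⟨C, -, hC⟩ := HemisphereAffineSlaving.abs_hsCompressibility_sub_one_le hH σ hσ c₁ hc₁
  have hρc := Clausius.continuous_bρ hφc w
  -- `Z = 1 + η f_ex'(η)` is measurable (Mathlib: the everywhere-defined `deriv` of any function is measurable)
  have measurable_hsCompressibility : Measurable hsCompressibility := by
    have h : hsCompressibility = fun η => 1 + η * deriv hsExcessFreeEnergy η := rfl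
    rw [h]
    exact measurable_const.add (measurable_id.mul (measurable_deriv _))
  have h1 : Integrable (fun x => bρ φ w x * bθ φ w x) := integrable_of_continuous_T3 (hρc.mul hθc)
  have h2 : AEStronglyMeasurable (fun x => hsCompressibility (bρ φ w x * σ ^ 3)) volume :=
    (measurable_hsCompressibility.comp (hρc.mul continuous_const).measurable).aestronglyMeasurable
  have h3 : ∀ x, ‖hsCompressibility (bρ φ w x * σ ^ 3)‖ ≤ C + 1 := fun x => by
    have h := hC (bρ φ w x) (hband x).1 (hband x).2
    rw [Real.norm_eq_abs]
    calc |hsCompressibility (bρ φ w x * σ ^ 3)|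
        = |(hsCompressibility (bρ φ w x * σ ^ 3) - 1) + 1| := by rw [sub_add_cancel]
      _ ≤ |hsCompressibility (bρ φ w x * σ ^ 3) - 1| + |(1 : ℝ)| := abs_add_le _ _
      _ ≤ C + 1 := by rw [abs_one]; linarith
  exact h1.mul_bdd h2 (ae_of_all _ h3)

/-- The collisional closure density `pref(x) · (p̄(x) − ρ̄(x) θ̄(x))` with a continuous prefactor is
integrable on a band configuration. -/
theorem integrable_closure (hH : StiffCollisionalRelaxation.HsFreeEnergyConvex) {σ c₁ : ℝ}
    (hσ : 0 < σ) (hc₁ : 0 < c₁) {φ : T3 → ℝ} (hφc : Continuous φ) (w : Config (n + 1) (Fin 3) T3)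
    (hband : ∀ x, c₁ ≤ bρ φ w x ∧ bρ φ w x * σ ^ 3 ≤ 1) {pref : T3 → ℝ} (hpref : Continuous pref) :
    Integrable (fun x => pref x * (hsPressure σ (bρ φ w x) (bθ φ w x) - bρ φ w x * bθ φ w x)) := by
  have hρ : ∀ x, bρ φ w x ≠ 0 := fun x => (hc₁.trans_le (hband x).1).ne'
  obtain ⟨-, -, -, hθc, -⟩ := continuous_blocks hφc w hρ
  obtain ⟨C, -, hC⟩ := exists_forall_abs_le_of_continuous hpref
  have hint : Integrable (fun x => hsPressure σ (bρ φ w x) (bθ φ w x) - bρ φ w x * bθ φ w x) :=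
    (integrable_pressure hH hσ hc₁ hφc w hband hθc).sub
      (integrable_of_continuous_T3 ((Clausius.continuous_bρ hφc w).mul hθc))
  exact hint.bdd_mul hpref.aestronglyMeasurable
    (ae_of_all _ fun x => by rw [Real.norm_eq_abs]; exact hC x)

/-! ## Block kinetic energy on the band and Cauchy–Schwarz -/

/-- **`∫ₓ (1 + |ū|)² ≤ 2 (1 + c₁⁻¹) (1 + ⟨emp w, |v|²⟩)`** on a band configuration `ρ̄ ≥ c₁`
(`|ū|² = |m̄|²/ρ̄² ≤ 2Ē/ρ̄ ≤ 2Ē/c₁` and `∫ₓ Ē = ⟨emp, |v|²/2⟩`). -/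
theorem integral_one_add_norm_bu_sq_le {φ : T3 → ℝ} (hφc : Continuous φ) (hφ0 : ∀ y, 0 ≤ φ y)
    (hφ1 : ∫ y, φ y = 1) (w : Config (n + 1) (Fin 3) T3) {c₁ : ℝ} (hc₁ : 0 < c₁)
    (hband : ∀ x, c₁ ≤ bρ φ w x) :
    ∫ x, (1 + ‖bu φ w x‖) ^ 2 ≤ 2 * (1 + c₁⁻¹) * (1 + ∫ y, ‖y.2‖ ^ 2 ∂(empiricalMeasure w)) := by
  have hpt : ∀ x, (1 + ‖bu φ w x‖) ^ 2 ≤ 2 + 4 * c₁⁻¹ * bE φ w x := by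
    intro x
    have hρ : c₁ ≤ bρ φ w x := hband x
    have hρ0 : 0 < bρ φ w x := hc₁.trans_le hρ
    have hE0 : 0 ≤ bE φ w x := by
      rw [bE_eq_sum]
      exact mul_nonneg (by positivity)
        (Finset.sum_nonneg fun i _ => mul_nonneg (hφ0 _) (by positivity))
    have hbm := Clausius.norm_bm_sq_le hφ0 w x
    have hsq : ‖bu φ w x‖ ^ 2 * c₁ ≤ 2 * bE φ w x := by
      have h1 : ‖bu φ w x‖ ^ 2 * bρ φ w x ^ 2 = ‖bm φ w x‖ ^ 2 := by
        rw [bu, norm_smul, mul_pow, norm_inv, Real.norm_eq_abs, inv_pow, sq_abs]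
        field_simp
      have h2 : ‖bu φ w x‖ ^ 2 * bρ φ w x ≤ 2 * bE φ w x := by
        have h3 : ‖bu φ w x‖ ^ 2 * bρ φ w x * bρ φ w x ≤ 2 * bE φ w x * bρ φ w x := by
          nlinarith [h1, hbm]
        exact le_of_mul_le_mul_right h3 hρ0
      nlinarith [sq_nonneg ‖bu φ w x‖]
    have hc : 0 < c₁⁻¹ := inv_pos.2 hc₁
    have hsq' : ‖bu φ w x‖ ^ 2 ≤ 2 * c₁⁻¹ * bE φ w x := by
      calc ‖bu φ w x‖ ^ 2 = ‖bu φ w x‖ ^ 2 * c₁ * c₁⁻¹ := by field_simp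
        _ ≤ 2 * bE φ w x * c₁⁻¹ := mul_le_mul_of_nonneg_right hsq hc.le
        _ = 2 * c₁⁻¹ * bE φ w x := by ring
    nlinarith [sq_nonneg (1 - ‖bu φ w x‖)]
  have hbEc : Continuous fun x => bE φ w x := Clausius.continuous_bE hφc w
  have hi : Integrable (fun x => 4 * c₁⁻¹ * bE φ w x) :=
    (integrable_of_continuous_T3 hbEc).const_mul _
  have hint : Integrable (fun x => 2 + 4 * c₁⁻¹ * bE φ w x) := (integrable_const _).add hi
  have hE : ∫ x, bE φ w x = 2⁻¹ * ∫ y, ‖y.2‖ ^ 2 ∂(empiricalMeasure w) := by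
    rw [Clausius.integral_bE hφc hφ1, Clausius.empiricalEnergyField_one, integral_empiricalMeasure]
    simp only [Finset.mul_sum]
    exact Finset.sum_congr rfl fun i _ => by ring
  have h0 : 0 ≤ ∫ y, ‖y.2‖ ^ 2 ∂(empiricalMeasure w) := integral_nonneg fun y => by positivity
  have hc : 0 ≤ c₁⁻¹ := by positivity
  calc ∫ x, (1 + ‖bu φ w x‖) ^ 2 ≤ ∫ x, (2 + 4 * c₁⁻¹ * bE φ w x) :=
        integral_mono_of_nonneg (ae_of_all _ fun x => by positivity) hint (ae_of_all _ hpt)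
    _ = 2 + 4 * c₁⁻¹ * ∫ x, bE φ w x := by
        rw [integral_add (integrable_const _) hi, integral_const, integral_const_mul, probReal_univ,
          one_smul]
    _ = 2 + 2 * c₁⁻¹ * ∫ y, ‖y.2‖ ^ 2 ∂(empiricalMeasure w) := by rw [hE]; ring
    _ ≤ 2 * (1 + c₁⁻¹) * (1 + ∫ y, ‖y.2‖ ^ 2 ∂(empiricalMeasure w)) := by nlinarith

/-! ## The integrated kinetic remainder -/

/-- **The integrated kinetic remainder** on a band configuration: with coefficient fields bounded by
`L`, `|∫ₓ [Σⱼₖ Mⱼₖ Dⱼₖ + Σⱼ Eⱼ (Σₖ Dⱼₖ ūₖ + qⱼ)]| ≤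
12 L √(2(1 + c₁⁻¹)) (∫ₓ Σ D² + |q|²)^{1/2} (1 + ⟨emp w, |v|²⟩)^{1/2}` (pointwise Cauchy–Schwarz in the
finite sums, Cauchy–Schwarz in `x`, and the band kinetic bound). -/
theorem integral_rem_le {φ : T3 → ℝ} (hφc : Continuous φ) (hφ0 : ∀ y, 0 ≤ φ y) (hφ1 : ∫ y, φ y = 1)
    (w : Config (n + 1) (Fin 3) T3) {c₁ L : ℝ} (hc₁ : 0 < c₁) (hL : 0 ≤ L)
    (hband : ∀ x, c₁ ≤ bρ φ w x) (Mx : Fin 3 → Fin 3 → T3 → ℝ) (Ex : Fin 3 → T3 → ℝ)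
    (hMx : ∀ j k x, |Mx j k x| ≤ L) (hEx : ∀ j x, |Ex j x| ≤ L) :
    |∫ x, ((∑ j, ∑ k, Mx j k x * bD φ w x j k) +
        ∑ j, Ex j x * ((∑ k, bD φ w x j k * bu φ w x k) + bq φ w x j))| ≤
      12 * L * Real.sqrt (2 * (1 + c₁⁻¹)) *
        Real.sqrt (∫ x, ((∑ j, ∑ k, bD φ w x j k ^ 2) + ‖bq φ w x‖ ^ 2)) *
        Real.sqrt (1 + ∫ y, ‖y.2‖ ^ 2 ∂(empiricalMeasure w)) := by
  -- Cauchy–Schwarz on the torus for continuous non-negative functions (as in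
  -- `Literature.Analysis.FunctionSpaces.Torus.integral_mul_le_sqrt_mul_sqrt_of_continuous`)
  have integral_mul_le_sqrt : ∀ {f g : T3 → ℝ}, Continuous f → Continuous g → (∀ x, 0 ≤ f x) →
      (∀ x, 0 ≤ g x) → ∫ x, f x * g x ≤ Real.sqrt (∫ x, f x ^ 2) * Real.sqrt (∫ x, g x ^ 2) := by
    intro f g hf hg hf0 hg0
    have hmem : ∀ {h : T3 → ℝ}, Continuous h → MemLp h (ENNReal.ofReal 2) volume := fun {h} hh => by
      obtain ⟨C, -, hC⟩ := exists_forall_abs_le_of_continuous hh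
      exact MemLp.of_bound hh.aestronglyMeasurable C
        (ae_of_all _ fun x => by rw [Real.norm_eq_abs]; exact hC x)
    have h := integral_mul_le_Lp_mul_Lq_of_nonneg Real.HolderConjugate.two_two (ae_of_all _ hf0)
      (ae_of_all _ hg0) (hmem hf) (hmem hg)
    simp only [Real.rpow_two, one_div, Real.sqrt_eq_rpow] at h ⊢
    exact h
  have hρ : ∀ x, bρ φ w x ≠ 0 := fun x => (hc₁.trans_le (hband x)).ne'
  obtain ⟨hu, -, -, -, hD, hq, -⟩ := continuous_blocks hφc w hρ
  have hSc : Continuous fun x => (∑ j, ∑ k, bD φ w x j k ^ 2) + ‖bq φ w x‖ ^ 2 :=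
    (continuous_finsetSum _ fun j _ => continuous_finsetSum _ fun k _ => (hD j k).pow 2).add
      (hq.norm.pow 2)
  have hS0 : ∀ x, 0 ≤ (∑ j, ∑ k, bD φ w x j k ^ 2) + ‖bq φ w x‖ ^ 2 := fun x => by positivity
  have hAc : Continuous fun x => Real.sqrt ((∑ j, ∑ k, bD φ w x j k ^ 2) + ‖bq φ w x‖ ^ 2) :=
    hSc.sqrt
  have hBc : Continuous fun x => 1 + ‖bu φ w x‖ := continuous_const.add hu.norm
  have hpt : ∀ x, |(∑ j, ∑ k, Mx j k x * bD φ w x j k) +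
      ∑ j, Ex j x * ((∑ k, bD φ w x j k * bu φ w x k) + bq φ w x j)| ≤
      12 * L * ((1 + ‖bu φ w x‖) * Real.sqrt ((∑ j, ∑ k, bD φ w x j k ^ 2) + ‖bq φ w x‖ ^ 2)) :=
    fun x => by
      rw [← mul_assoc]
      exact rem_abs_le hL (fun j k => Mx j k x) (fun j => Ex j x) (fun j k => hMx j k x)
        (fun j => hEx j x) (fun j k => bD φ w x j k) (bu φ w x) (bq φ w x)
  have hBA : Integrable (fun x => 12 * L * ((1 + ‖bu φ w x‖) *
      Real.sqrt ((∑ j, ∑ k, bD φ w x j k ^ 2) + ‖bq φ w x‖ ^ 2))) :=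
    (integrable_of_continuous_T3 (hBc.mul hAc)).const_mul _
  have hK := integral_one_add_norm_bu_sq_le hφc hφ0 hφ1 w hc₁ hband
  have hA2 : ∫ x, Real.sqrt ((∑ j, ∑ k, bD φ w x j k ^ 2) + ‖bq φ w x‖ ^ 2) ^ 2 =
      ∫ x, ((∑ j, ∑ k, bD φ w x j k ^ 2) + ‖bq φ w x‖ ^ 2) :=
    integral_congr_ae (Eventually.of_forall fun x => Real.sq_sqrt (hS0 x))
  have h12 : 0 ≤ 12 * L := by positivity
  calc |∫ x, ((∑ j, ∑ k, Mx j k x * bD φ w x j k) +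
          ∑ j, Ex j x * ((∑ k, bD φ w x j k * bu φ w x k) + bq φ w x j))|
      ≤ ∫ x, |(∑ j, ∑ k, Mx j k x * bD φ w x j k) +
          ∑ j, Ex j x * ((∑ k, bD φ w x j k * bu φ w x k) + bq φ w x j)| :=
        abs_integral_le_integral_abs
    _ ≤ ∫ x, 12 * L * ((1 + ‖bu φ w x‖) *
          Real.sqrt ((∑ j, ∑ k, bD φ w x j k ^ 2) + ‖bq φ w x‖ ^ 2)) :=
        integral_mono_of_nonneg (ae_of_all _ fun x => abs_nonneg _) hBA (ae_of_all _ hpt)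
    _ = 12 * L * ∫ x, (1 + ‖bu φ w x‖) *
          Real.sqrt ((∑ j, ∑ k, bD φ w x j k ^ 2) + ‖bq φ w x‖ ^ 2) := integral_const_mul _ _
    _ ≤ 12 * L * (Real.sqrt (∫ x, (1 + ‖bu φ w x‖) ^ 2) *
          Real.sqrt (∫ x, Real.sqrt ((∑ j, ∑ k, bD φ w x j k ^ 2) + ‖bq φ w x‖ ^ 2) ^ 2)) :=
        mul_le_mul_of_nonneg_left (integral_mul_le_sqrt hBc hAc (fun x => by positivity)
          (fun x => Real.sqrt_nonneg _)) h12
    _ ≤ 12 * L * (Real.sqrt (2 * (1 + c₁⁻¹) * (1 + ∫ y, ‖y.2‖ ^ 2 ∂(empiricalMeasure w))) *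
          Real.sqrt (∫ x, ((∑ j, ∑ k, bD φ w x j k ^ 2) + ‖bq φ w x‖ ^ 2))) := by
        rw [hA2]
        exact mul_le_mul_of_nonneg_left
          (mul_le_mul_of_nonneg_right (Real.sqrt_le_sqrt hK) (Real.sqrt_nonneg _)) h12
    _ = _ := by
        rw [Real.sqrt_mul (by positivity : (0 : ℝ) ≤ 2 * (1 + c₁⁻¹))]
        ring

/-! ## Uniform bounds for derivatives of the entropy variables -/

/-- **Uniform sup and Lipschitz bounds** on `[0, t] × 𝕋³`, `t < T`, for a finite family of scalar
fields jointly smooth on `[0, T) × 𝕋³`: continuity on the compact `[0, t] × 𝕋³` of the fields and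
of their torus gradients, and the mean value inequality in the minimal-image distance. -/
theorem family_bounds {T t : ℝ} (htT : t < T) (f : Fin 3 → Fin 3 → ℝ → T3 → ℝ)
    (hf : ∀ j k, Torus.IsSmoothSpaceTimeOn (Ico 0 T) (f j k)) :
    ∃ L₀ : ℝ, 0 ≤ L₀ ∧ ∀ L, L₀ ≤ L → ∀ j k, ∀ s ∈ Icc (0 : ℝ) t,
      (∀ x, |f j k s x| ≤ L) ∧ ∀ x y, |f j k s x - f j k s y| ≤ L * Torus.euclidDist x y := by
  have hU : UniqueDiffOn ℝ (Ico (0 : ℝ) T) := uniqueDiffOn_Ico 0 T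
  have hK : IsCompact (Icc (0 : ℝ) t) := isCompact_Icc
  have hKS : Icc (0 : ℝ) t ⊆ Ico 0 T := Icc_subset_Ico_right htT
  have h1 : ∀ j k, ∃ C : ℝ, ∀ s ∈ Icc (0 : ℝ) t, ∀ x, ‖f j k s x‖ ≤ C := fun j k =>
    (hf j k).exists_norm_le_of_isCompact hK hKS
  have h2 : ∀ j k, ∃ C : ℝ, ∀ s ∈ Icc (0 : ℝ) t, ∀ x, ‖Torus.gradient (f j k s) x‖ ≤ C :=
    fun j k => ((hf j k).gradient hU).exists_norm_le_of_isCompact hK hKS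
  choose C hC using h1
  choose G hG using h2
  refine ⟨∑ j, ∑ k, (|C j k| + |G j k|),
    Finset.sum_nonneg fun _ _ => Finset.sum_nonneg fun _ _ => by positivity, ?_⟩
  intro L hL j k s hs
  have hle : |C j k| + |G j k| ≤ ∑ j', ∑ k', (|C j' k'| + |G j' k'|) := by
    calc |C j k| + |G j k| ≤ ∑ k', (|C j k'| + |G j k'|) :=
          Finset.single_le_sum (f := fun k' => |C j k'| + |G j k'|) (fun _ _ => by positivity)
            (Finset.mem_univ k)
      _ ≤ ∑ j', ∑ k', (|C j' k'| + |G j' k'|) :=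
          Finset.single_le_sum (f := fun j' => ∑ k', (|C j' k'| + |G j' k'|))
            (fun _ _ => Finset.sum_nonneg fun _ _ => by positivity) (Finset.mem_univ j)
  have hCL : ∀ x, |f j k s x| ≤ L := fun x => by
    have h := hC j k s hs x
    rw [Real.norm_eq_abs] at h
    linarith [le_abs_self (C j k), abs_nonneg (G j k)]
  have hGL : ∀ x, ‖Torus.gradient (f j k s) x‖ ≤ L := fun x => by
    linarith [hG j k s hs x, le_abs_self (G j k), abs_nonneg (C j k)]
  exact ⟨hCL, B4.abs_sub_le_mul_euclidDist ((hf j k).isSmooth_slice (hKS hs)) hGL⟩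

end EngineBlockClosure

/-- Registered helper sub-goal `engine_blockClosure_remainder` of `engine_blockClosure`: the integrated
kinetic remainder on a band configuration (`EngineBlockClosure.integral_rem_le`) — for a continuous kernel
`φ ≥ 0` of unit mass, a configuration with `ρ̄ ≥ c₁ > 0` on every block and coefficient fields bounded
by `L`, `|∫ₓ [Σⱼₖ Mⱼₖ Dⱼₖ + Σⱼ Eⱼ (Σₖ Dⱼₖ ūₖ + qⱼ)]| ≤
12 L √(2(1 + c₁⁻¹)) (∫ₓ Σ D² + |q|²)^{1/2} (1 + ⟨emp w, |v|²⟩)^{1/2}`. [folklore] -/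
theorem engine_blockClosure_remainder : ∀ {n : ℕ} (φ : T3 → ℝ) (w : Config (n + 1) (Fin 3) T3) (c₁ L : ℝ) (Mx : Fin 3 → Fin 3 → T3 → ℝ) (Ex : Fin 3 → T3 → ℝ), Continuous φ → (∀ y, 0 ≤ φ y) → ∫ y, φ y = 1 → 0 < c₁ → 0 ≤ L → (∀ x, c₁ ≤ bρ φ w x) → (∀ j k x, |Mx j k x| ≤ L) → (∀ j x, |Ex j x| ≤ L) → |∫ x, ((∑ j, ∑ k, Mx j k x * bD φ w x j k) + ∑ j, Ex j x * ((∑ k, bD φ w x j k * bu φ w x k) + bq φ w x j))| ≤ 12 * L * Real.sqrt (2 * (1 + c₁⁻¹)) * Real.sqrt (∫ x, ((∑ j, ∑ k, bD φ w x j k ^ 2) + ‖bq φ w x‖ ^ 2)) * Real.sqrt (1 + ∫ y, ‖y.2‖ ^ 2 ∂(empiricalMeasure w)) :=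
  fun _ w _ _ Mx Ex hφc hφ0 hφ1 hc₁ hL hband hMx hEx =>
    EngineBlockClosure.integral_rem_le hφc hφ0 hφ1 w hc₁ hL hband Mx Ex hMx hEx

end Barycentric

end Summit.AtomisticToContinuum.HydrodynamicLimit.Theorems.MacroClosureLine

end
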